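import Summits.CriticalPhenomena.SAWScalingLimit.Theorems.SimpleSubseqLimits.Negative.SimpleSubseqLimitsHonesty
import Literature.Probability.RandomPlanarGeometry.SAWScalingLimitFamily
import Literature.Probability.Percolation.CLE6Proofs

/-!
# Negative-side results for the crux `SAWLoopFugacityFlow.SimpleSubseqLimits` (stmt-CriticalPhenomena-4982):
FREE CLAUSES and the CORE of the crux; `reachable` is idle (work-file §5–§6).

For EVERY weak subsequential limit `ν` of the critical SAW laws along an honest endpoint
approximation, `ν`-a.e. curve class starts at `a = D.pt 0`, ends at `b = D.pt 1` and has its trace in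
`closure D` — by continuity of `source`/`target`, confinement of lattice polylines to `Ω̄`, and the
portmanteau inequality for closed events (`FiniteMeasure.limsup_measure_closed_le_of_tendsto`), with
no SAW estimate at all. Hence the crux is EQUIVALENT to its core "ν-a.e. simple ∧ boundary-avoiding"
(`simpleSubseqLimits_iff_core`): a refutation must break simplicity or boundary avoidance, a proof
need only establish them. Moreover the field `IsEndpointApprox.reachable` is idle: the crux is
equivalent to its version without it (`simpleSubseqLimits_iff_withoutReachable`), so no
`_false_without_reachable` theorem exists.

Refuter `cdisprove` (standing adversary); the full indexed work file is
`Summits/CriticalPhenomena/SAWScalingLimit/Cruxes/SimpleSubseqLimits/Disproof.lean`.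
-/

noncomputable section

open MeasureTheory Filter Topology Set Metric
open Literature.Probability.RandomPlanarGeometry Literature.Probability.RandomPlanarGeometry.SAW
open Literature.Probability.LatticeModels
open scoped ENNReal NNReal BoundedContinuousFunction

namespace Summit.CriticalPhenomena.SAWScalingLimit.Theorems.SimpleSubseqLimits.Negative

open Summit.CriticalPhenomena.SAWScalingLimit.Theses.SAWLoopFugacityFlow (SimpleSubseqLimits)

variable {D : DobrushinDomain} {a b : ℝ → Site 2} {s : ℕ → ℝ} {ν : Measure (CurveClass ℂ)}

/-! ## §5 Free clauses -/

/-- **Portmanteau transfer.** If the SAW laws along `s n` converge weakly to the probability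
measure `ν` and, for all large `n`, EVERY SAW curve at mesh `s n` lies in the closed set `F`, then
`ν` is carried by `F` (honesty of the laws + `FiniteMeasure.limsup_measure_closed_le_of_tendsto`).
[cite: BillingsleyCPM1999, Thm. 2.1] -/
theorem ae_mem_of_isClosed_of_weakLimitAlong {F : Set (CurveClass ℂ)} (hF : IsClosed F)
    [IsProbabilityMeasure ν] (h : WeakLimitAlong D a b s ν)
    (hmem : ∀ᶠ n in atTop, ∀ γ : DomainSAW D.carrier (s n) (a (s n)) (b (s n)), γ.curve ∈ F) :
    ∀ᵐ γ ∂ν, γ ∈ F := by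
  let μs : ℕ → FiniteMeasure (CurveClass ℂ) := fun n =>
    ⟨(law D.carrier (s n) (a (s n)) (b (s n))).map (fun γ => γ.curve), inferInstance⟩
  let μ : FiniteMeasure (CurveClass ℂ) := ⟨ν, inferInstance⟩
  have hlim : Tendsto μs atTop (𝓝 μ) := by
    rw [FiniteMeasure.tendsto_iff_forall_integral_tendsto]
    intro f
    refine (h f).congr fun n => ?_
    change _ = ∫ x, f x ∂((law D.carrier (s n) (a (s n)) (b (s n))).map (fun γ => γ.curve))
    rw [integral_map (DomainSAW.measurable_of_top _).aemeasurable f.continuous.aestronglyMeasurable]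
  have hle := FiniteMeasure.limsup_measure_closed_le_of_tendsto hlim hF
  have hev : ∀ᶠ n in atTop,
      ((μs n : FiniteMeasure (CurveClass ℂ)) : Measure (CurveClass ℂ)) F = 1 := by
    filter_upwards [eventually_isProbabilityMeasure_of_weakLimitAlong h, hmem] with n hn hn'
    haveI := hn.1
    change ((law D.carrier (s n) (a (s n)) (b (s n))).map (fun γ => γ.curve)) F = 1
    rw [Measure.map_apply (DomainSAW.measurable_of_top _) hF.measurableSet]
    have : (fun γ : DomainSAW D.carrier (s n) (a (s n)) (b (s n)) => γ.curve) ⁻¹' F = univ :=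
      eq_univ_of_forall fun γ => hn' γ
    rw [this, measure_univ]
  have h1 : limsup (fun n => ((μs n : FiniteMeasure (CurveClass ℂ)) : Measure (CurveClass ℂ)) F)
      atTop = 1 := by
    rw [limsup_congr hev, limsup_const]
  rw [h1] at hle
  have hνF : ν F = 1 := le_antisymm prob_le_one hle
  have hc : ν Fᶜ = 0 := (prob_compl_eq_zero_iff hF.measurableSet).2 hνF
  rw [ae_iff]
  exact hc

/-- Distinct limits force distinct endpoints along the sequence. [folklore] -/
theorem eventually_ne_of_isEndpointApprox (hab : IsEndpointApprox D a b)
    (hs : Tendsto s atTop (𝓝[>] (0 : ℝ))) : ∀ᶠ n in atTop, a (s n) ≠ b (s n) := by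
  have hne : D.pt 0 ≠ D.pt 1 := fun h => absurd (D.pt_injective h) (by decide)
  obtain ⟨U, V, hU, hV, hxU, hyV, hUV⟩ := t2_separation hne
  filter_upwards [(hab.tendsto_fst.comp hs).eventually (hU.mem_nhds hxU),
    (hab.tendsto_snd.comp hs).eventually (hV.mem_nhds hyV)] with n ha hb
  intro h
  simp only [Function.comp_apply, h] at ha
  exact Set.disjoint_iff.1 hUV ⟨ha, hb⟩

/-- Every SAW curve between DISTINCT vertices of `Ω_δ` has its trace in `closure Ω` (its darts
are mesh-graph edges, whose closed segments lie in `Ω̄` by definition). [folklore] -/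
theorem curve_range_subset_closure {Ω : Set ℂ} {δ : ℝ} {u v : Site 2} (huv : u ≠ v)
    (γ : DomainSAW Ω δ u v) : γ.curve.range ⊆ closure Ω := by
  simp only [DomainSAW.curve, CurveClass.range_mk]
  refine SimpleGraph.Walk.range_toCurve_subset_of_not_nil (fun hn => huv hn.eq) fun d _ => ?_
  exact (meshGraph_adj_iff.1 (discreteDomainGraph_adj_iff.1 d.adj).1).2

/-- **The endpoint and confinement clauses of the crux are FREE.** For every subsequential weak
limit `ν` of the critical SAW laws along an honest endpoint approximation, `ν`-a.e. curve class
starts at `a`, ends at `b` and has its trace in `closure D`. [folklore] -/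
theorem ae_source_target_range_of_weakLimitAlong (hab : IsEndpointApprox D a b)
    (hs : Tendsto s atTop (𝓝[>] (0 : ℝ))) [IsProbabilityMeasure ν] (h : WeakLimitAlong D a b s ν) :
    ∀ᵐ γ ∂ν, γ.source = D.pt 0 ∧ γ.target = D.pt 1 ∧ γ.range ⊆ closure D.carrier := by
  have hsrc : ∀ k : ℕ, ∀ᵐ γ ∂ν,
      γ ∈ {c : CurveClass ℂ | dist c.source (D.pt 0) ≤ 1 / ((k : ℝ) + 1)} := by
    intro k
    refine ae_mem_of_isClosed_of_weakLimitAlong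
      (isClosed_le (continuous_dist.comp (CurveClass.continuous_source.prodMk continuous_const))
        continuous_const) h ?_
    have hev := (hab.tendsto_fst.comp hs).eventually
      (closedBall_mem_nhds (D.pt 0) (by positivity : (0 : ℝ) < 1 / ((k : ℝ) + 1)))
    filter_upwards [hev] with n hn γ
    simp only [DomainSAW.curve, CurveClass.source_mk, Curve.source_def]
    change dist (γ.walk.toCurve (meshPoint (s n)) 0) (D.pt 0) ≤ _
    rw [SimpleGraph.Walk.toCurve_apply_zero]
    exact hn
  have htgt : ∀ k : ℕ, ∀ᵐ γ ∂ν,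
      γ ∈ {c : CurveClass ℂ | dist c.target (D.pt 1) ≤ 1 / ((k : ℝ) + 1)} := by
    intro k
    refine ae_mem_of_isClosed_of_weakLimitAlong
      (isClosed_le (continuous_dist.comp (CurveClass.continuous_target.prodMk continuous_const))
        continuous_const) h ?_
    have hev := (hab.tendsto_snd.comp hs).eventually
      (closedBall_mem_nhds (D.pt 1) (by positivity : (0 : ℝ) < 1 / ((k : ℝ) + 1)))
    filter_upwards [hev] with n hn γ
    simp only [DomainSAW.curve, CurveClass.target_mk, Curve.target_def]
    change dist (γ.walk.toCurve (meshPoint (s n)) 1) (D.pt 1) ≤ _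
    rw [SimpleGraph.Walk.toCurve_apply_one]
    exact hn
  have hrange : ∀ᵐ γ ∂ν, γ ∈ CurveClass.rangeSubset (closure D.carrier) := by
    refine ae_mem_of_isClosed_of_weakLimitAlong
      (CurveClass.isClosed_rangeSubset isClosed_closure) h ?_
    filter_upwards [eventually_ne_of_isEndpointApprox hab hs] with n hn γ
    exact curve_range_subset_closure hn γ
  rw [← ae_all_iff] at hsrc htgt
  filter_upwards [hsrc, htgt, hrange] with γ h0 h1 h2
  refine ⟨?_, ?_, h2⟩
  · by_contra hne
    obtain ⟨k, hk⟩ := exists_nat_one_div_lt (dist_pos.2 hne)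
    exact absurd (h0 k) (not_le.2 hk)
  · by_contra hne
    obtain ⟨k, hk⟩ := exists_nat_one_div_lt (dist_pos.2 hne)
    exact absurd (h1 k) (not_le.2 hk)

/-- The CORE of the crux: simplicity and boundary avoidance of subsequential limits (hypotheses
verbatim, conclusion reduced to its two genuine clauses) — an equivalent form of the route item,
proved equivalent below (not a literature fact). -/
def SimpleSubseqLimitsCore : Prop :=
  ∀ (D : DobrushinDomain) (a b : ℝ → Site 2), IsEndpointApprox D a b →
    ∀ (s : ℕ → ℝ) (ν : Measure (CurveClass ℂ)), Tendsto s atTop (𝓝[>] (0 : ℝ)) →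
      IsProbabilityMeasure ν → WeakLimitAlong D a b s ν →
        ∀ᵐ γ ∂ν, γ ∈ CurveClass.simple ∧ γ.range ∩ frontier D.carrier ⊆ {D.pt 0, D.pt 1}

/-- **The crux is equivalent to its core** (simplicity ∧ boundary avoidance): the clauses
`source = a`, `target = b`, `range ⊆ closure D` are theorems for every subsequential limit.
[folklore] -/
theorem simpleSubseqLimits_iff_core : SimpleSubseqLimits ↔ SimpleSubseqLimitsCore := by
  constructor
  · intro h D a b hab s ν hs hν hw
    exact (h D a b hab s ν hs hν hw).mono fun γ hγ => ⟨hγ.1, hγ.2.2.2.2⟩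
  · intro h D a b hab s ν hs hν hw
    filter_upwards [h D a b hab s ν hs hν hw, ae_source_target_range_of_weakLimitAlong hab hs hw]
      with γ h1 h2
    exact ⟨h1.1, h2.1, h2.2.1, h2.2.2, h1.2⟩

/-! ## §6 `IsEndpointApprox.reachable` is idle -/

/-- The crux with `IsEndpointApprox D a b` weakened by DROPPING `reachable` (keeping the two
endpoint limits), conclusion verbatim — an equivalent form of the route item, proved equivalent
below (not a literature fact). -/
def SimpleSubseqLimitsWithoutReachable : Prop :=
  ∀ (D : DobrushinDomain) (a b : ℝ → Site 2),
    Tendsto (fun δ => meshPoint δ (a δ)) (𝓝[>] (0 : ℝ)) (𝓝 (D.pt 0)) →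
    Tendsto (fun δ => meshPoint δ (b δ)) (𝓝[>] (0 : ℝ)) (𝓝 (D.pt 1)) →
    ∀ (s : ℕ → ℝ) (ν : Measure (CurveClass ℂ)), Tendsto s atTop (𝓝[>] (0 : ℝ)) →
      IsProbabilityMeasure ν → WeakLimitAlong D a b s ν → ∀ᵐ γ ∂ν, Carrier D γ

/-- Test integrals against the SAW law only depend on the endpoints (transport along equalities
of sites; the types `DomainSAW Ω δ u v` depend on them). [folklore] -/
theorem integral_law_congr {Ω : Set ℂ} {δ : ℝ} {u v u' v' : Site 2} (hu : u = u') (hv : v = v')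
    (f : CurveClass ℂ →ᵇ ℝ) :
    ∫ γ, f γ.curve ∂(law Ω δ u v) = ∫ γ, f γ.curve ∂(law Ω δ u' v') := by
  subst hu hv; rfl

/-- **`reachable` is idle**: the crux is EQUIVALENT to its version without
`IsEndpointApprox.reachable`. (`→`: along the sequence the laws are honest for large `n`, so the
endpoints are joined there; off the sequence repair the approximation by an honest one,
`SAW.exists_isEndpointApprox`, wherever `a δ`, `b δ` are not joined — the repaired pair is an
`IsEndpointApprox` with the same laws along `s n` eventually, and the crux applies to it.)
[folklore] -/
theorem simpleSubseqLimits_iff_withoutReachable :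
    SimpleSubseqLimits ↔ SimpleSubseqLimitsWithoutReachable := by
  classical
  constructor
  · intro h D a b ha hb s ν hs hν hw
    obtain ⟨a₀, b₀, h₀⟩ := exists_isEndpointApprox D
    haveI := hν
    let R : ℝ → Prop := fun δ => (discreteDomainGraph D.carrier δ).Reachable (a δ) (b δ)
    let a' : ℝ → Site 2 := fun δ => if R δ then a δ else a₀ δ
    let b' : ℝ → Site 2 := fun δ => if R δ then b δ else b₀ δ
    have key : ∀ (c c₀ : ℝ → Site 2) (p : ℂ),
        Tendsto (fun δ => meshPoint δ (c δ)) (𝓝[>] (0 : ℝ)) (𝓝 p) →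
        Tendsto (fun δ => meshPoint δ (c₀ δ)) (𝓝[>] (0 : ℝ)) (𝓝 p) →
        Tendsto (fun δ => meshPoint δ (if R δ then c δ else c₀ δ)) (𝓝[>] (0 : ℝ)) (𝓝 p) := by
      intro c c₀ p hc hc₀
      have : (fun δ => meshPoint δ (if R δ then c δ else c₀ δ)) =
          fun δ => if R δ then meshPoint δ (c δ) else meshPoint δ (c₀ δ) := by
        funext δ; split_ifs <;> rfl
      rw [this]
      exact hc.if' hc₀
    have hab' : IsEndpointApprox D a' b' := by
      refine ⟨?_, key a a₀ _ ha h₀.tendsto_fst, key b b₀ _ hb h₀.tendsto_snd⟩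
      filter_upwards [h₀.reachable] with δ hδ
      by_cases hR : R δ
      · simp only [a', b', if_pos hR]; exact hR
      · simp only [a', b', if_neg hR]; exact hδ
    have hev : ∀ᶠ n in atTop, R (s n) :=
      (eventually_isProbabilityMeasure_of_weakLimitAlong hw).mono fun n hn => hn.2
    have hw' : WeakLimitAlong D a' b' s ν := by
      intro f
      refine (hw f).congr' ?_
      filter_upwards [hev] with n hn
      have h1 : a (s n) = a' (s n) := by simp only [a', if_pos hn]
      have h2 : b (s n) = b' (s n) := by simp only [b', if_pos hn]
      exact integral_law_congr h1 h2 f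
    exact h D a' b' hab' s ν hs hν hw'
  · intro h D a b hab s ν hs hν hw
    exact h D a b hab.tendsto_fst hab.tendsto_snd s ν hs hν hw

end Summit.CriticalPhenomena.SAWScalingLimit.Theorems.SimpleSubseqLimits.Negative
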